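import Literature.Combinatorics.Enumerative.SporadicSupercongruenceCompanionProofs
import Literature.Combinatorics.Enumerative.MultivariateAperyGZeroProofs
import Literature.Combinatorics.Enumerative.MultivariateAperyJacobsthalRatioProofs
import Mathlib.Tactic
import HarnessLib

/-!
# Osburn–Sahu–Straub 2016, proof of Theorem 1.2: `G₀(mp^r) = Σ_{p∤k} ℬ(mp^r, k) ≡ 0 (mod p^{3r})`

Topic `Literature/Combinatorics/Enumerative`, namespace `Literature.Combinatorics.Enumerative.SporadicSupercongruenceProofs`
(fourth file of the chain `…TermProofs` / `…HalfBlockProofs` → `…CompanionProofs` → `…GZeroProofs` → `…Proofs`, which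
DISCHARGES the named fact `AperyGaussCongruences.oss2016_theorem12`). PROOF FILE: sorry-free theorems only — no
definition, no named fact. Source read on the page (held `paper:arxiv-1312.2195`, §2 pp. 5–6): R. Osburn, B. Sahu,
A. Straub, *Supercongruences for sporadic sequences*, Proc. Edinb. Math. Soc. **59** (2016) 503–518
[OsburnSahuStraub2016]. HONEST FRAMING (cell pub-zeta5): classical `p`-adic congruences for Apéry-like numbers;
nothing here concerns `ζ(5)`.

## What is printed (verbatim, [OsburnSahuStraub2016] §2, Proof of Theorem 1.2)

«It therefore remains to show that (G0) `G₀(mp^r) = Σ'_k ℬ(mp^r, k) ≡ 0 (mod p^{3r})`. Note that (binom1)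
`C(mp^r, k) = (mp^r/k) C(mp^r − 1, k − 1)` is divisible by `p^r` if `p ∤ k`. Hence, if `A ≥ 3` then (G0) is obviously
true and (12) follows. In the remainder, we consider the case `A = 2`. With (binom1) substituted into (G0), we find
that we need to show that (G0k) `Σ'_k (1/k²) C(mp^r − 1, k − 1)² C(mp^r + k, k)^B C(2k, mp^r)^C ≡ 0 (mod p^r)`. If
`p ∤ k` then `[(k−1)/p] = [k/p]` so that, by Lemma 2.4, `C(mp^r − 1, k − 1)² ≡ C(mp^{r−1} − 1, [k/p])² (mod p^r)`.
… congruence (G0k) is equivalent to (sumC1) … In particular, the case `s = 1` proves (sumC1) and thus (12).»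

## What is proved (natural arguments, `N = p^r m`, `m ≥ 1`, `r ≥ 1`, `p ≥ 5`)

The weights `1/k²` are `(Ring.inverse k)²` in `ℤ_[p]` (as in the tree's `MultivariateAperyGZeroProofs`, whose
`mul_choose_sub_one` is (binom1)). Instead of passing through (sumC1) we use Lemma 2.4 twice, at `k − 1` and at `k`
(«`[(k−1)/p] = [k/p]`», tree `sub_one_div_eq`), so that `C(mp^r − 1, k − 1)² ≡ C(mp^r − 1, k)² (mod p^r)` and (G0k)
becomes the case `s = 0` of (sumCs0), i.e. `…CompanionProofs.pow_dvd_weighted_companion_sum` at `t = r` — the same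
chain of printed congruences, composed in a different order.
* `pow_dvd_sum_not_dvd_termS_two` — (G0) for `A = 2`; **`pow_dvd_sum_not_dvd_termS`** — (G0) for every `A ≥ 2`
  (for `A ≥ 3` termwise from `p^r ∣ C(p^r m, k)`, tree `pow_sub_dvd_choose`).
-/

open Finset

namespace Literature.Combinatorics.Enumerative.SporadicSupercongruenceProofs

open MultivariateAperyNumbers (lemma54)
open MultivariateAperyPrimePowerProofs (mul_choose_sub_one sub_one_div_eq pow_sub_dvd_choose)

section GZero

variable {p : ℕ} [hp : Fact p.Prime]

omit hp in
/-- A natural number is a unit of `ℤ_p` iff it is prime to `p`. [folklore] -/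
private theorem isUnit_natCast_padicInt_iff_gz [Fact p.Prime] (K : ℕ) : IsUnit ((K : ℤ_[p])) ↔ ¬ p ∣ K := by
  rw [PadicInt.isUnit_iff, ← PadicInt.norm_natCast_lt_one_iff (p := p)]
  have := PadicInt.norm_le_one ((K : ℤ_[p]))
  constructor
  · intro h; rw [h]; exact lt_irrefl 1
  · intro h; exact le_antisymm this (not_lt.mp h)

/-- `Ring.inverse k · k = 1` in `ℤ_p` for `p ∤ k`. [folklore] -/
private theorem ringInverse_natCast_mul_self_gz {K : ℕ} (hK : ¬ p ∣ K) :
    Ring.inverse ((K : ℤ_[p])) * (K : ℤ_[p]) = 1 :=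
  Ring.inverse_mul_cancel _ ((isUnit_natCast_padicInt_iff_gz K).mpr hK)

/-- `Ring.inverse k = 0` in `ℤ_p` for `p ∣ k`. [folklore] -/
private theorem ringInverse_natCast_of_dvd_gz {K : ℕ} (hK : p ∣ K) : Ring.inverse ((K : ℤ_[p])) = 0 :=
  Ring.inverse_non_unit _ (fun h => (isUnit_natCast_padicInt_iff_gz K).mp h hK)

omit hp in
/-- Squares kill the signs of Lemma 2.4: `((−1)^n a)² = a²`. [folklore] -/
private theorem neg_one_pow_mul_sq_gz (n : ℕ) (a : ℤ) : ((-1) ^ n * a) ^ 2 = a ^ 2 := by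
  rw [mul_pow, ← pow_mul, mul_comm n 2, pow_mul, neg_one_sq, one_pow, one_mul]

omit hp in
/-- **«If `p ∤ k` then `[(k−1)/p] = [k/p]` so that, by Lemma 2.4», read twice**: for a prime `p`, `r ≥ 1`,
`m ≥ 1`, `k ≥ 1`, `p ∤ k`, `C(mp^r − 1, k − 1)² ≡ C(mp^r − 1, k)² (mod p^r)` (both sides are
`≡ C(mp^{r−1} − 1, [k/p])²`). [cite: OsburnSahuStraub2016, Theorem 1.2 (proof, (binomind1)) with Lemma 2.4] -/
theorem choose_sub_one_sq_modEq (hpr : p.Prime) {r : ℕ} (hr : 1 ≤ r) {m : ℕ} (hm : 1 ≤ m) {k : ℕ}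
    (hk : 1 ≤ k) (hpk : ¬ p ∣ k) :
    (((p ^ r * m - 1).choose (k - 1) : ℕ) : ℤ) ^ 2 ≡ (((p ^ r * m - 1).choose k : ℕ) : ℤ) ^ 2
      [ZMOD (p : ℤ) ^ r] := by
  have hA := lemma54 hpr hr hm (k - 1)
  have hB := lemma54 hpr hr hm k
  rw [sub_one_div_eq (p := p) hk hpk] at hA
  have h := (hA.trans hB.symm).pow 2
  rwa [neg_one_pow_mul_sq_gz, neg_one_pow_mul_sq_gz] at h

/-- An integer congruence of naturals as a divisibility in `ℤ_p`. [folklore] -/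
private theorem padicInt_pow_dvd_sub_of_modEq_gz {ρ a b : ℕ} (h : (a : ℤ) ≡ b [ZMOD (p : ℤ) ^ ρ]) :
    (p : ℤ_[p]) ^ ρ ∣ (a : ℤ_[p]) - (b : ℤ_[p]) := by
  obtain ⟨c, hc⟩ := Int.ModEq.dvd h.symm
  refine ⟨(c : ℤ_[p]), ?_⟩
  have := congrArg (Int.cast : ℤ → ℤ_[p]) hc
  push_cast at this
  exact this

/-- **(G0) for `A = 2`**: for a prime `p ≥ 5`, `r ≥ 1`, `m ≥ 1` and all `B, C ≥ 0`,
`p^{3r} ∣ Σ_{0 ≤ k ≤ mp^r, p∤k} C(mp^r,k)² C(mp^r+k,k)^B C(2k,mp^r)^C`. Printed route: (binom1)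
`C(mp^r,k)² = (mp^r)² k⁻² C(mp^r−1,k−1)²` in `ℤ_p`, Lemma 2.4 (`C(mp^r−1,k−1)² ≡ C(mp^r−1,k)²`), and the case
`s = 0` of (sumCs0) (`…CompanionProofs.pow_dvd_weighted_companion_sum` at `t = r`).
[cite: OsburnSahuStraub2016, Theorem 1.2 (proof, (G0)–(G0k), A = 2)] -/
theorem pow_dvd_sum_not_dvd_termS_two (h5 : 5 ≤ p) (B C : ℕ) {r : ℕ} (hr : 1 ≤ r) {m : ℕ} (hm : 1 ≤ m) :
    (p : ℤ) ^ (3 * r) ∣ ∑ k ∈ range (p ^ r * m + 1),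
      (if p ∣ k then 0 else
        ((((p ^ r * m).choose k) ^ 2 * ((p ^ r * m + k).choose k) ^ B *
          ((2 * k).choose (p ^ r * m)) ^ C : ℕ) : ℤ)) := by
  have hp' := hp.out
  -- pass to `ℤ_p`
  rw [show ((p : ℤ) ^ (3 * r)) = ((p ^ (3 * r) : ℕ) : ℤ) by push_cast; rfl]
  rw [show ((p ^ (3 * r) : ℕ) : ℤ) = (p ^ (3 * r) : ℤ) by push_cast; rfl, ← PadicInt.pow_p_dvd_int_iff]
  push_cast
  -- (binom1): `C(N,k)² = p^{2r} m² · k⁻² · C(N−1,k−1)²` termwise (`p ∤ k`), `0 = 0` otherwise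
  have hterm : ∀ k ∈ range (p ^ r * m + 1),
      (if p ∣ k then (0 : ℤ_[p]) else
        (((p ^ r * m).choose k : ℕ) : ℤ_[p]) ^ 2 * (((p ^ r * m + k).choose k : ℕ) : ℤ_[p]) ^ B *
          (((2 * k).choose (p ^ r * m) : ℕ) : ℤ_[p]) ^ C) =
      ((p : ℤ_[p]) ^ (2 * r) * ((m : ℤ_[p]) ^ 2)) * ((Ring.inverse ((k : ℤ_[p]))) ^ 2 *
        ((((p ^ r * m - 1).choose (k - 1)) ^ 2 * ((p ^ r * m + k).choose k) ^ B *
          ((2 * k).choose (p ^ r * m)) ^ C : ℕ) : ℤ_[p])) := by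
    intro k _
    split_ifs with hk
    · rw [ringInverse_natCast_of_dvd_gz hk, zero_pow two_ne_zero, zero_mul, mul_zero]
    · have hk1 : 1 ≤ k := Nat.one_le_iff_ne_zero.mpr fun h => hk (h ▸ dvd_zero p)
      have hid := mul_choose_sub_one (m := p ^ r * m) hk1
      have hcast : (((p ^ r * m).choose k : ℕ) : ℤ_[p]) * (k : ℤ_[p]) =
          (p : ℤ_[p]) ^ r * (m : ℤ_[p]) * (((p ^ r * m - 1).choose (k - 1) : ℕ) : ℤ_[p]) := by
        exact_mod_cast hid.symm
      have hinv := ringInverse_natCast_mul_self_gz (p := p) hk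
      push_cast
      calc (((p ^ r * m).choose k : ℕ) : ℤ_[p]) ^ 2 * (((p ^ r * m + k).choose k : ℕ) : ℤ_[p]) ^ B *
            (((2 * k).choose (p ^ r * m) : ℕ) : ℤ_[p]) ^ C
          = (Ring.inverse ((k : ℤ_[p])) * (k : ℤ_[p])) ^ 2 *
              ((((p ^ r * m).choose k : ℕ) : ℤ_[p]) ^ 2 * (((p ^ r * m + k).choose k : ℕ) : ℤ_[p]) ^ B *
                (((2 * k).choose (p ^ r * m) : ℕ) : ℤ_[p]) ^ C) := by rw [hinv, one_pow, one_mul]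
        _ = (Ring.inverse ((k : ℤ_[p]))) ^ 2 *
              (((((p ^ r * m).choose k : ℕ) : ℤ_[p]) * (k : ℤ_[p])) ^ 2 *
                (((p ^ r * m + k).choose k : ℕ) : ℤ_[p]) ^ B * (((2 * k).choose (p ^ r * m) : ℕ) : ℤ_[p]) ^ C) := by
          ring
        _ = _ := by rw [hcast]; ring
  rw [Finset.sum_congr rfl hterm, ← Finset.mul_sum, show 3 * r = 2 * r + r by ring, pow_add, mul_assoc]
  refine mul_dvd_mul_left _ (Dvd.dvd.mul_left ?_ _)
  -- Lemma 2.4 twice: `C(N−1,k−1)² ≡ C(N−1,k)²` termwise for `p ∤ k`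
  have hC1 : (p : ℤ_[p]) ^ r ∣ ∑ k ∈ range (p ^ r * m + 1), ((Ring.inverse ((k : ℤ_[p]))) ^ 2 *
        ((((p ^ r * m - 1).choose (k - 1)) ^ 2 * ((p ^ r * m + k).choose k) ^ B *
          ((2 * k).choose (p ^ r * m)) ^ C : ℕ) : ℤ_[p]) -
      (Ring.inverse ((k : ℤ_[p]))) ^ 2 *
        ((((p ^ r * m - 1).choose k) ^ 2 * ((p ^ r * m + k).choose k) ^ B *
          ((2 * k).choose (p ^ r * m)) ^ C : ℕ) : ℤ_[p])) := by
    refine Finset.dvd_sum fun k _ => ?_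
    by_cases hk : p ∣ k
    · rw [ringInverse_natCast_of_dvd_gz hk, zero_pow two_ne_zero, zero_mul, zero_mul, sub_self]
      exact dvd_zero _
    · have hk1 : 1 ≤ k := Nat.one_le_iff_ne_zero.mpr fun h => hk (h ▸ dvd_zero p)
      rw [← mul_sub]
      refine Dvd.dvd.mul_left ?_ _
      have hsq := choose_sub_one_sq_modEq (p := p) hp' hr hm hk1 hk
      obtain ⟨c, hc⟩ := Int.ModEq.dvd hsq.symm
      have hc' := congrArg (Int.cast : ℤ → ℤ_[p]) hc
      push_cast at hc' ⊢
      refine ⟨(c : ℤ_[p]) * ((((p ^ r * m + k).choose k : ℕ) : ℤ_[p]) ^ B *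
        (((2 * k).choose (p ^ r * m) : ℕ) : ℤ_[p]) ^ C), ?_⟩
      linear_combination ((((p ^ r * m + k).choose k : ℕ) : ℤ_[p]) ^ B *
        (((2 * k).choose (p ^ r * m) : ℕ) : ℤ_[p]) ^ C) * hc'
  -- the case `s = 0` of (sumCs0); the last term (`k = N`, `p ∣ N`) vanishes
  have hC2 : (p : ℤ_[p]) ^ r ∣ ∑ k ∈ range (p ^ r * m + 1), (Ring.inverse ((k : ℤ_[p]))) ^ 2 *
        ((((p ^ r * m - 1).choose k) ^ 2 * ((p ^ r * m + k).choose k) ^ B *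
          ((2 * k).choose (p ^ r * m)) ^ C : ℕ) : ℤ_[p]) := by
    have hpN : p ∣ p ^ r * m := Dvd.dvd.mul_right (dvd_pow_self p (by omega)) m
    rw [Finset.sum_range_succ, ringInverse_natCast_of_dvd_gz hpN, zero_pow two_ne_zero, zero_mul, add_zero]
    have hW := pow_dvd_weighted_companion_sum (p := p) h5 B C r hm r le_rfl
    simp only [Nat.sub_self, pow_zero, Nat.div_one] at hW
    exact hW
  have := dvd_add hC1 hC2
  rw [← Finset.sum_add_distrib] at this
  simpa using this

/-- **(G0) `G₀(mp^r) ≡ 0 (mod p^{3r})` for every `A ≥ 2`**: for a prime `p ≥ 5`, `r ≥ 1`, `m ≥ 1`, `B, C ≥ 0`,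
`p^{3r} ∣ Σ_{0 ≤ k ≤ mp^r, p∤k} C(mp^r,k)^A C(mp^r+k,k)^B C(2k,mp^r)^C`; «if `A ≥ 3` then (G0) is obviously true»
(each `C(mp^r, k)`, `p ∤ k`, is divisible by `p^r` — tree `pow_sub_dvd_choose`), and `A = 2` is
`pow_dvd_sum_not_dvd_termS_two`. [cite: OsburnSahuStraub2016, Theorem 1.2 (proof, (G0))] -/
theorem pow_dvd_sum_not_dvd_termS (h5 : 5 ≤ p) {A : ℕ} (hA : 2 ≤ A) (B C : ℕ) {r : ℕ} (hr : 1 ≤ r) {m : ℕ}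
    (hm : 1 ≤ m) :
    (p : ℤ) ^ (3 * r) ∣ ∑ k ∈ range (p ^ r * m + 1),
      (if p ∣ k then 0 else
        ((((p ^ r * m).choose k) ^ A * ((p ^ r * m + k).choose k) ^ B *
          ((2 * k).choose (p ^ r * m)) ^ C : ℕ) : ℤ)) := by
  have hp' := hp.out
  rcases hA.eq_or_lt with h2 | h3
  · subst h2
    exact pow_dvd_sum_not_dvd_termS_two h5 B C hr hm
  · refine Finset.dvd_sum fun k _ => ?_
    split_ifs with hk
    · exact dvd_zero _
    · have hk1 : 1 ≤ k := Nat.one_le_iff_ne_zero.mpr fun h => hk (h ▸ dvd_zero p)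
      have hd := pow_sub_dvd_choose (p := p) (Nat.zero_le r) hk1 hk m
      rw [Nat.sub_zero, pow_zero, one_mul] at hd
      have hdA : p ^ (3 * r) ∣ ((p ^ r * m).choose k) ^ A := by
        rw [pow_mul']
        exact (pow_dvd_pow_of_dvd hd 3).trans (pow_dvd_pow _ (by omega))
      have h := (hdA.mul_right (((p ^ r * m + k).choose k) ^ B)).mul_right (((2 * k).choose (p ^ r * m)) ^ C)
      have := Int.natCast_dvd_natCast.mpr h
      push_cast at this
      exact_mod_cast this

end GZero

end Literature.Combinatorics.Enumerative.SporadicSupercongruenceProofs
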